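import Mathlib
import Summits.Ventures.PercRepro2.Defs
import Summits.Ventures.PercRepro2.Graph

/-!
# The fixpoint rule for single-vertex reducibility, as a decidable predicate (blind cell
PercRepro2, p1 g11; ASSIGNMENTS v12.28 (7′): «the fixpoint rule as a Lean `def blocked` /
`def reducibleByFixpoint` over the type pattern, so that «hard cell» is a decidable predicate —
the definition only»)

LEAD-CCW (c‴) addendum: in a typed instance `(ends, τ)` with marks `o, a₁, a₂, a₃, b`, call an
unmarked vertex `v` BLOCKED relative to a set `U` of already-unblocked unmarked vertices if `v`
carries no piece of type `3` and carries two pieces of type `2` to DISTINCT labels `x ≠ y` such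
that neither (`y ∈ U` and `x` is adjacent to `y`) nor (`x ∈ U` and `y` is adjacent to `x`). Let
`U*` be the least fixpoint of «add every unmarked vertex not blocked relative to `U`», from `∅`.
PREDICTION (the lead's, tested on the complete order censuses): the cell is single-vertex
reducible iff `U*` contains every unmarked vertex; the HARD cells are exactly the others.

Everything below is a finite Boolean computation (`decide`-able on a concrete instance):
`hasPieceTo`, `hasType3`, `adjacent`, `blocked`, `unblockStep`, `fixpointU` (the step iterated
`|V|` times — it is monotone, so this is the least fixpoint), `reducibleByFixpoint`, `HardCell`.
No claim is proved here; the rule is the lead's prediction, stated so that it can be named.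
-/

namespace Summit.Ventures.PercRepro2

namespace Fixpoint

variable {V : Type*} {E : Type*} [Fintype V] [DecidableEq V] [Fintype E] [DecidableEq E]

/-- `v` carries a piece (an edge `{v, x}`) of type `t` to the label `x`. -/
def hasPieceTo (ends : E → Sym2 V) (τ : E → ℕ) (v x : V) (t : ℕ) : Prop :=
  ∃ e, ends e = s(v, x) ∧ τ e = t

/-- `v` carries a non-loop piece of type `3` (pinned open: contracts). -/
def hasType3 (ends : E → Sym2 V) (τ : E → ℕ) (v : V) : Prop :=
  ∃ e, v ∈ ends e ∧ ¬ (ends e).IsDiag ∧ τ e = 3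

/-- `x` and `y` are adjacent. -/
def adjacent (ends : E → Sym2 V) (x y : V) : Prop := x ≠ y ∧ ∃ e, ends e = s(x, y)

omit [Fintype V] in
/-- `hasPieceTo` is decidable. -/
instance hasPieceTo.decidable (ends : E → Sym2 V) (τ : E → ℕ) (v x : V) (t : ℕ) :
    Decidable (hasPieceTo ends τ v x t) := by
  unfold hasPieceTo
  infer_instance

omit [Fintype V] in
/-- `hasType3` is decidable. -/
instance hasType3.decidable (ends : E → Sym2 V) (τ : E → ℕ) (v : V) :
    Decidable (hasType3 ends τ v) := by
  unfold hasType3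
  infer_instance

omit [Fintype V] in
/-- `adjacent` is decidable. -/
instance adjacent.decidable (ends : E → Sym2 V) (x y : V) : Decidable (adjacent ends x y) := by
  unfold adjacent
  infer_instance

/-- **Blocked** relative to `U`: no type-`3` piece, and two type-`2` pieces to distinct labels
`x ≠ y` such that neither (`y ∈ U` and `x ~ y`) nor (`x ∈ U` and `y ~ x`). -/
def blocked (ends : E → Sym2 V) (τ : E → ℕ) (U : Finset V) (v : V) : Prop :=
  ¬ hasType3 ends τ v ∧
    ∃ x y : V, x ≠ y ∧ v ≠ x ∧ v ≠ y ∧ hasPieceTo ends τ v x 2 ∧ hasPieceTo ends τ v y 2 ∧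
      ¬ (y ∈ U ∧ adjacent ends x y) ∧ ¬ (x ∈ U ∧ adjacent ends y x)

/-- `blocked` is decidable. -/
instance blocked.decidable (ends : E → Sym2 V) (τ : E → ℕ) (U : Finset V) (v : V) :
    Decidable (blocked ends τ U v) := by
  unfold blocked
  infer_instance

/-- The unmarked vertices. -/
def unmarked (o a₁ a₂ a₃ b : V) : Finset V := Finset.univ \ {o, a₁, a₂, a₃, b}

/-- One step of the fixpoint: add every unmarked vertex not blocked relative to `U`. -/
def unblockStep (ends : E → Sym2 V) (τ : E → ℕ) (o a₁ a₂ a₃ b : V) (U : Finset V) : Finset V :=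
  U ∪ (unmarked o a₁ a₂ a₃ b).filter fun v => ¬ blocked ends τ U v

/-- The least fixpoint `U*` (the monotone step iterated `|V|` times from `∅`). -/
def fixpointU (ends : E → Sym2 V) (τ : E → ℕ) (o a₁ a₂ a₃ b : V) : Finset V :=
  (unblockStep ends τ o a₁ a₂ a₃ b)^[Fintype.card V] ∅

/-- **Single-vertex reducibility by the fixpoint rule**: every unmarked vertex is unblocked. -/
def reducibleByFixpoint (ends : E → Sym2 V) (τ : E → ℕ) (o a₁ a₂ a₃ b : V) : Prop :=
  ∀ v ∈ unmarked o a₁ a₂ a₃ b, v ∈ fixpointU ends τ o a₁ a₂ a₃ b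

/-- `reducibleByFixpoint` is decidable. -/
instance reducibleByFixpoint.decidable (ends : E → Sym2 V) (τ : E → ℕ) (o a₁ a₂ a₃ b : V) :
    Decidable (reducibleByFixpoint ends τ o a₁ a₂ a₃ b) := by
  unfold reducibleByFixpoint
  infer_instance

/-- **A hard cell**: not single-vertex reducible by the fixpoint rule (it keeps a non-mergeable
pair of type-`2` pieces). -/
def HardCell (ends : E → Sym2 V) (τ : E → ℕ) (o a₁ a₂ a₃ b : V) : Prop :=
  ¬ reducibleByFixpoint ends τ o a₁ a₂ a₃ b

/-- `HardCell` is decidable. -/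
instance HardCell.decidable (ends : E → Sym2 V) (τ : E → ℕ) (o a₁ a₂ a₃ b : V) :
    Decidable (HardCell ends τ o a₁ a₂ a₃ b) := by
  unfold HardCell
  infer_instance

omit [DecidableEq E] in
/-- The unblocking step is inflationary. -/
lemma subset_unblockStep (ends : E → Sym2 V) (τ : E → ℕ) (o a₁ a₂ a₃ b : V) (U : Finset V) :
    U ⊆ unblockStep ends τ o a₁ a₂ a₃ b U :=
  Finset.subset_union_left

end Fixpoint

end Summit.Ventures.PercRepro2
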